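import Literature.MathematicalPhysics.QuantumLattice.PatchPairOperator
import HarnessLib

/-!
# Lattice-point count for the `d`-wave gap: at least almost half the Brillouin zone is non-nodal

Topic `MathematicalPhysics/QuantumLattice`, family `hubbard` (written for route `IsoperimetricCascade`,
support `FlatAGPNormGrowth`, stmt-HubbardSuperconductivity-11982).

**The lattice-point count**: away from its nodal lines the `d`-wave gap is bounded below on at
least (almost) half of the Brillouin zone, uniformly in the side `L`:
for every `δ ∈ (0,1)`, with `ε = δ/4`, for all large `L`

  `(1 - δ)/2 · L² ≤ #{k ∈ (ℤ/Lℤ)² : ε ≤ |cos p₁(k) - cos p₂(k)|}`   (`exists_card_dWaveGap_ge`).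

Proof (elementary): the half-zone translation `k₂ ↦ k₂ + ⌊L/2⌋` flips the sign of `cos p₂` up to
`π/L` (`|cos(p + π - θ) + cos p| ≤ θ`), hence maps a momentum with `|cos p₁ - cos p₂| < ε` but
`|cos p₁| ≥ 2ε` to one with `|cos p₁ - cos p₂| ≥ ε` (injectively); the exceptional momenta
`|cos p₁| < 2ε` number at most `L(2εL + 2)` by Jordan's inequality `|cos x| ≥ (2/π)|x - π/2|` on
`[0, π]` and a count of integers in an interval. No definition is introduced.
-/

namespace Literature.MathematicalPhysics.QuantumLattice

open Finset Real
open Literature.Probability.LatticeModels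

/-! ### Integers in an interval; Jordan's inequality for the cosine -/

/-- A finite set of integers all within `w/2` of a point has at most `w + 1` elements. [folklore] -/
theorem card_le_of_abs_sub_lt (s : Finset ℤ) (c w : ℝ) (hw : 0 ≤ w)
    (h : ∀ z ∈ s, |(z : ℝ) - c| < w / 2) : (s.card : ℝ) ≤ w + 1 := by
  have hsub : s ⊆ Finset.Ioo ⌊c - w / 2⌋ ⌈c + w / 2⌉ := by
    intro z hz
    have hz' := h z hz
    rw [abs_lt] at hz'
    rw [Finset.mem_Ioo, Int.floor_lt, Int.lt_ceil]
    constructor <;> linarith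
  have hcard := Finset.card_le_card hsub
  rw [Int.card_Ioo] at hcard
  have h1 : ((⌈c + w / 2⌉ - ⌊c - w / 2⌋ - 1 : ℤ) : ℝ) < w + 1 := by
    push_cast
    linarith [Int.ceil_lt_add_one (c + w / 2), Int.sub_one_lt_floor (c - w / 2)]
  have h2 : ((⌈c + w / 2⌉ - ⌊c - w / 2⌋ - 1).toNat : ℝ) ≤ w + 1 := by
    rcases le_or_gt 0 (⌈c + w / 2⌉ - ⌊c - w / 2⌋ - 1) with hnn | hneg
    · have : (((⌈c + w / 2⌉ - ⌊c - w / 2⌋ - 1).toNat : ℤ) : ℝ) =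
          ((⌈c + w / 2⌉ - ⌊c - w / 2⌋ - 1 : ℤ) : ℝ) := by
        rw [Int.toNat_of_nonneg hnn]
      rw [Int.cast_natCast] at this
      linarith
    · rw [Int.toNat_eq_zero.2 hneg.le, Nat.cast_zero]
      linarith
  calc (s.card : ℝ) ≤ ((⌈c + w / 2⌉ - ⌊c - w / 2⌋ - 1).toNat : ℝ) := by exact_mod_cast hcard
    _ ≤ w + 1 := h2

/-- **Jordan's inequality for the cosine** on `[0, π]`: `(2/π)|x - π/2| ≤ |cos x|`. [folklore] -/
theorem mul_abs_sub_pi_div_two_le_abs_cos {x : ℝ} (h0 : 0 ≤ x) (hπ : x ≤ π) :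
    2 / π * |x - π / 2| ≤ |Real.cos x| := by
  rw [← Real.sin_pi_div_two_sub]
  set y := π / 2 - x with hy
  have hy1 : -(π / 2) ≤ y := by rw [hy]; linarith
  have hy2 : y ≤ π / 2 := by rw [hy]; linarith
  have habs : |x - π / 2| = |y| := by rw [hy, abs_sub_comm]
  rw [habs]
  rcases le_or_gt 0 y with hpos | hneg
  · rw [abs_of_nonneg hpos]
    exact (Real.mul_le_sin hpos hy2).trans (le_abs_self _)
  · rw [abs_of_neg hneg]
    have h := Real.mul_le_sin (neg_nonneg.2 hneg.le) (by linarith)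
    rw [Real.sin_neg] at h
    exact h.trans (neg_le_abs _)

/-- Jordan's inequality on the second half period: `(2/π)|x - 3π/2| ≤ |cos x|` for `x ∈ [π, 2π]`.
[folklore] -/
theorem mul_abs_sub_three_pi_div_two_le_abs_cos {x : ℝ} (h0 : π ≤ x) (h2π : x ≤ 2 * π) :
    2 / π * |x - 3 * π / 2| ≤ |Real.cos x| := by
  have h := mul_abs_sub_pi_div_two_le_abs_cos (x := x - π) (by linarith) (by linarith)
  rw [show x - π - π / 2 = x - 3 * π / 2 by ring, Real.cos_sub_pi, abs_neg] at h
  exact h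

/-! ### Momenta with small `|cos p|` on the cyclic group -/

/-- **Few lattice angles have a small cosine**: `#{j ∈ ℤ/Lℤ : |cos(2πj/L)| < η} ≤ ηL + 2`.
[folklore] -/
theorem card_abs_cos_lt_le {L : ℕ} [NeZero L] {η : ℝ} (hη : 0 < η) :
    ((Finset.univ.filter fun j : ZMod L =>
        |Real.cos (2 * π * ((j.val : ℕ) : ℝ) / L)| < η).card : ℝ) ≤ η * L + 2 := by
  have hL : (0 : ℝ) < L := by exact_mod_cast Nat.pos_of_ne_zero (NeZero.ne L)
  set B := Finset.univ.filter fun j : ZMod L => |Real.cos (2 * π * ((j.val : ℕ) : ℝ) / L)| < η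
    with hB
  -- embed into `ℤ` through the canonical representatives
  set f : ZMod L → ℤ := fun j => (j.val : ℤ) with hf
  have hfinj : Function.Injective f := fun a b (h : ((a.val : ℕ) : ℤ) = ((b.val : ℕ) : ℤ)) =>
    ZMod.val_injective L (by exact_mod_cast h)
  set I := B.image f with hI
  have hIcard : I.card = B.card := Finset.card_image_of_injective B hfinj
  -- split according to the half period
  set I₁ := I.filter fun z : ℤ => |(z : ℝ) - L / 4| < η * L / 4 with hI₁
  set I₂ := I.filter fun z : ℤ => |(z : ℝ) - 3 * L / 4| < η * L / 4 with hI₂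
  have hcover : I ⊆ I₁ ∪ I₂ := by
    intro z hz
    rw [Finset.mem_union, hI₁, hI₂, Finset.mem_filter, Finset.mem_filter]
    rw [hI, Finset.mem_image] at hz
    obtain ⟨j, hj, rfl⟩ := hz
    rw [hB, Finset.mem_filter] at hj
    have hcos := hj.2
    set x : ℝ := 2 * π * ((j.val : ℕ) : ℝ) / L with hx
    have hx0 : 0 ≤ x := by rw [hx]; positivity
    have hxlt : x < 2 * π := by
      rw [hx, div_lt_iff₀ hL]
      have : ((j.val : ℕ) : ℝ) < L := by exact_mod_cast ZMod.val_lt j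
      nlinarith [Real.pi_pos]
    have hzx : ((f j : ℤ) : ℝ) = x * L / (2 * π) := by
      rw [hf, hx]
      push_cast
      field_simp
    rcases le_or_gt x π with hxπ | hxπ
    · left
      refine ⟨Finset.mem_image_of_mem f (by rw [hB, Finset.mem_filter]; exact hj), ?_⟩
      have hj2 := mul_abs_sub_pi_div_two_le_abs_cos hx0 hxπ
      have h3 : |x - π / 2| < π * η / 2 := by
        have := hj2.trans_lt hcos
        rw [div_mul_eq_mul_div, div_lt_iff₀ Real.pi_pos] at this
        linarith
      rw [hzx, show x * L / (2 * π) - L / 4 = (x - π / 2) * (L / (2 * π)) by field_simp; ring,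
        abs_mul, abs_of_pos (by positivity : (0 : ℝ) < L / (2 * π))]
      calc |x - π / 2| * (L / (2 * π)) < π * η / 2 * (L / (2 * π)) := by gcongr
        _ = η * L / 4 := by field_simp; ring
    · right
      refine ⟨Finset.mem_image_of_mem f (by rw [hB, Finset.mem_filter]; exact hj), ?_⟩
      have hj2 := mul_abs_sub_three_pi_div_two_le_abs_cos hxπ.le hxlt.le
      have h3 : |x - 3 * π / 2| < π * η / 2 := by
        have := hj2.trans_lt hcos
        rw [div_mul_eq_mul_div, div_lt_iff₀ Real.pi_pos] at this
        linarith
      rw [hzx, show x * L / (2 * π) - 3 * L / 4 = (x - 3 * π / 2) * (L / (2 * π)) by field_simp; ring,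
        abs_mul, abs_of_pos (by positivity : (0 : ℝ) < L / (2 * π))]
      calc |x - 3 * π / 2| * (L / (2 * π)) < π * η / 2 * (L / (2 * π)) := by gcongr
        _ = η * L / 4 := by field_simp; ring
  have h1 : (I₁.card : ℝ) ≤ η * L / 2 + 1 :=
    card_le_of_abs_sub_lt I₁ (L / 4) (η * L / 2) (by positivity) fun z hz => by
      have := (Finset.mem_filter.1 hz).2; linarith [this]
  have h2 : (I₂.card : ℝ) ≤ η * L / 2 + 1 :=
    card_le_of_abs_sub_lt I₂ (3 * L / 4) (η * L / 2) (by positivity) fun z hz => by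
      have := (Finset.mem_filter.1 hz).2; linarith [this]
  have h3 : B.card ≤ I₁.card + I₂.card := by
    rw [← hIcard]
    exact (Finset.card_le_card hcover).trans (Finset.card_union_le _ _)
  have h3' : (B.card : ℝ) ≤ I₁.card + I₂.card := by exact_mod_cast h3
  linarith

/-! ### The half-zone translation and the count of non-nodal momenta -/

/-- Unfolding a component of `latticeMomentum`. [folklore] -/
theorem latticeMomentum_eq {d : ℕ} (L : ℕ) (k : TorusSite d L) (i : Fin d) :
    latticeMomentum L k i = 2 * π * ((k i).val : ℝ) / L := rfl

/-- Reducing the representative modulo `L` does not change the lattice cosine. [folklore] -/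
theorem cos_two_pi_mul_mod_div (x L : ℕ) (hL : (0 : ℝ) < L) :
    Real.cos (2 * π * ((x % L : ℕ) : ℝ) / L) = Real.cos (2 * π * (x : ℝ) / L) := by
  have h := Nat.mod_add_div x L
  have hx : ((x % L : ℕ) : ℝ) = (x : ℝ) - L * ((x / L : ℕ) : ℝ) := by
    have : ((x % L : ℕ) : ℝ) + L * ((x / L : ℕ) : ℝ) = x := by exact_mod_cast h
    linarith
  rw [hx, show 2 * π * ((x : ℝ) - L * ((x / L : ℕ) : ℝ)) / L =
      2 * π * (x : ℝ) / L - ((x / L : ℕ) : ℝ) * (2 * π) by field_simp,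
    Real.cos_sub_nat_mul_two_pi]

/-- **The half-zone translation flips `cos p₂` up to `π/L`**: for `s = ⌊L/2⌋`,
`|cos p₂(k + s e₂) + cos p₂(k)| ≤ π/L`. [folklore] -/
theorem abs_cos_latticeMomentum_translate_add_le {L : ℕ} [NeZero L] (k : TorusSite 2 L) :
    |Real.cos (latticeMomentum L (k + Pi.single 1 ((L / 2 : ℕ) : ZMod L)) 1) +
        Real.cos (latticeMomentum L k 1)| ≤ π / L := by
  have hL : (0 : ℝ) < L := by exact_mod_cast Nat.pos_of_ne_zero (NeZero.ne L)
  have hLpos : 0 < L := Nat.pos_of_ne_zero (NeZero.ne L)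
  have hs : (((L / 2 : ℕ) : ZMod L)).val = L / 2 := by
    rw [ZMod.val_natCast, Nat.mod_eq_of_lt (Nat.div_lt_self hLpos one_lt_two)]
  -- the translated momentum, as a real angle
  have hval : Real.cos (latticeMomentum L (k + Pi.single 1 ((L / 2 : ℕ) : ZMod L)) 1) =
      Real.cos (latticeMomentum L k 1 + 2 * π * ((L / 2 : ℕ) : ℝ) / L) := by
    rw [latticeMomentum_eq, latticeMomentum_eq, Pi.add_apply, Pi.single_eq_same, ZMod.val_add, hs,
      cos_two_pi_mul_mod_div _ _ hL, Nat.cast_add]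
    congr 1
    ring
  -- `2π ⌊L/2⌋ / L = π - θ`, `θ = π (L mod 2)/L ∈ [0, π/L]`
  set θ : ℝ := π * ((L % 2 : ℕ) : ℝ) / L with hθ
  have hdm : 2 * π * ((L / 2 : ℕ) : ℝ) / L = π - θ := by
    have h2 : (2 * ((L / 2 : ℕ) : ℝ)) = (L : ℝ) - ((L % 2 : ℕ) : ℝ) := by
      have := Nat.div_add_mod L 2
      have h' : (2 * ((L / 2 : ℕ) : ℝ)) + ((L % 2 : ℕ) : ℝ) = L := by exact_mod_cast this
      linarith
    rw [hθ, show 2 * π * ((L / 2 : ℕ) : ℝ) = π * (2 * ((L / 2 : ℕ) : ℝ)) by ring, h2]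
    field_simp
  have hθ0 : 0 ≤ θ := by rw [hθ]; positivity
  have hθ1 : θ ≤ π / L := by
    rw [hθ]
    have : ((L % 2 : ℕ) : ℝ) ≤ 1 := by exact_mod_cast Nat.lt_succ_iff.1 (Nat.mod_lt L two_pos)
    calc π * ((L % 2 : ℕ) : ℝ) / L ≤ π * 1 / L := by gcongr
      _ = π / L := by rw [mul_one]
  rw [hval, hdm, show latticeMomentum L k 1 + (π - θ) = (latticeMomentum L k 1 - θ) + π by ring,
    Real.cos_add_pi, neg_add_eq_sub]
  calc |Real.cos (latticeMomentum L k 1) - Real.cos (latticeMomentum L k 1 - θ)|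
      ≤ |latticeMomentum L k 1 - (latticeMomentum L k 1 - θ)| := Real.abs_cos_sub_cos_le _ _
    _ = θ := by rw [sub_sub_cancel, abs_of_nonneg hθ0]
    _ ≤ π / L := hθ1

/-- The translation does not touch the first momentum component. [folklore] -/
theorem latticeMomentum_translate_zero {L : ℕ} (k : TorusSite 2 L) (s : ZMod L) :
    latticeMomentum L (k + Pi.single 1 s) 0 = latticeMomentum L k 0 := by
  rw [latticeMomentum_eq, latticeMomentum_eq, Pi.add_apply,
    Pi.single_eq_of_ne (show (0 : Fin 2) ≠ 1 by decide), add_zero]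

/-- Exceptional momenta (`|cos p₁| < η`) form a product set of size `L · #{j : |cos(2πj/L)| < η}`.
[folklore] -/
theorem card_filter_abs_cos_fst_lt {L : ℕ} [NeZero L] (η : ℝ) :
    (Finset.univ.filter fun k : TorusSite 2 L => |Real.cos (latticeMomentum L k 0)| < η).card =
      L * (Finset.univ.filter fun j : ZMod L => |Real.cos (2 * π * ((j.val : ℕ) : ℝ) / L)| < η).card := by
  rw [Finset.card_filter, Finset.card_filter, ← (piFinTwoEquiv fun _ : Fin 2 => ZMod L).symm.sum_comp,
    Fintype.sum_prod_type, Finset.mul_sum]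
  refine Finset.sum_congr rfl fun a _ => ?_
  simp only [piFinTwoEquiv_symm_apply, latticeMomentum_eq, Fin.cons_zero]
  rw [Finset.sum_const, Finset.card_univ, ZMod.card, smul_eq_mul]

/-- **At least (almost) half of the Brillouin zone is non-nodal**: for `δ ∈ (0,1)` and all large
`L`, `(1 - δ)/2 · L² ≤ #{k : δ/4 ≤ |cos p₁(k) - cos p₂(k)|}`. [folklore] -/
theorem exists_card_dWaveGap_ge {δ : ℝ} (hδ0 : 0 < δ) (hδ1 : δ < 1) :
    ∃ L₁ : ℕ, ∀ (L : ℕ) [NeZero L], L₁ ≤ L →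
      (1 - δ) / 2 * (L : ℝ) ^ 2 ≤
        ((Finset.univ.filter fun k : TorusSite 2 L => δ / 4 ≤ |dWaveGap k|).card : ℝ) := by
  refine ⟨⌈4 * π / δ⌉₊ + 1, fun L _ hL₁ => ?_⟩
  have hL : (0 : ℝ) < L := by exact_mod_cast Nat.pos_of_ne_zero (NeZero.ne L)
  have hLge : 4 * π / δ ≤ L := by
    have h1 := Nat.le_ceil (4 * π / δ)
    have h2 : ((⌈4 * π / δ⌉₊ + 1 : ℕ) : ℝ) ≤ L := by exact_mod_cast hL₁
    push_cast at h2
    linarith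
  have hπL : π / L ≤ δ / 4 := by
    rw [div_le_div_iff₀ hL (by norm_num : (0:ℝ) < 4)]
    rw [div_le_iff₀ hδ0] at hLge
    linarith
  have hδL : 4 ≤ δ * L := by
    rw [div_le_iff₀ hδ0] at hLge
    nlinarith [Real.pi_gt_three]
  set ε : ℝ := δ / 4 with hε
  have hε0 : 0 < ε := by rw [hε]; positivity
  -- the good, bad and exceptional momenta
  set G := Finset.univ.filter fun k : TorusSite 2 L => ε ≤ |dWaveGap k| with hG
  set Bd := Finset.univ.filter fun k : TorusSite 2 L => ¬ (ε ≤ |dWaveGap k|) with hBd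
  set E := Finset.univ.filter fun k : TorusSite 2 L => |Real.cos (latticeMomentum L k 0)| < 2 * ε with hE
  have hsplit : G.card + Bd.card = Fintype.card (TorusSite 2 L) := by
    rw [hG, hBd, Finset.card_filter_add_card_filter_not, Finset.card_univ]
  have hcardT : (Fintype.card (TorusSite 2 L) : ℝ) = (L : ℝ) ^ 2 := by
    rw [Fintype.card_fun, ZMod.card, Fintype.card_fin]
    push_cast
    ring
  -- the translation maps bad non-exceptional momenta injectively into good ones
  set T : TorusSite 2 L → TorusSite 2 L := fun k => k + Pi.single 1 ((L / 2 : ℕ) : ZMod L) with hT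
  have hTinj : Set.InjOn T ↑(Bd \ E) := fun a _ b _ h => add_right_cancel h
  have hTmaps : ∀ k ∈ Bd \ E, T k ∈ G := by
    intro k hk
    rw [Finset.mem_sdiff, hBd, hE, Finset.mem_filter, Finset.mem_filter, not_le] at hk
    obtain ⟨⟨-, hbad⟩, hexc⟩ := hk
    have hexc' : 2 * ε ≤ |Real.cos (latticeMomentum L k 0)| := by
      by_contra h
      exact hexc ⟨Finset.mem_univ _, not_le.1 h⟩
    rw [hG, Finset.mem_filter]
    refine ⟨Finset.mem_univ _, ?_⟩
    have hflip := abs_cos_latticeMomentum_translate_add_le k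
    rw [dWaveGap] at hbad ⊢
    rw [hT]
    simp only []
    rw [latticeMomentum_translate_zero]
    -- `|a - c'| ≥ |a + c| - |c' + c| ≥ 2|a| - |a - c| - π/L`
    have h1 : |Real.cos (latticeMomentum L k 0) + Real.cos (latticeMomentum L k 1)| ≥
        2 * |Real.cos (latticeMomentum L k 0)| - |Real.cos (latticeMomentum L k 0) - Real.cos (latticeMomentum L k 1)| := by
      have := abs_sub_abs_le_abs_sub (2 * Real.cos (latticeMomentum L k 0))
        (Real.cos (latticeMomentum L k 0) - Real.cos (latticeMomentum L k 1))
      rw [abs_mul, abs_two, show 2 * Real.cos (latticeMomentum L k 0) -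
        (Real.cos (latticeMomentum L k 0) - Real.cos (latticeMomentum L k 1)) =
        Real.cos (latticeMomentum L k 0) + Real.cos (latticeMomentum L k 1) by ring] at this
      linarith
    have h2 : |Real.cos (latticeMomentum L k 0) -
        Real.cos (latticeMomentum L (k + Pi.single 1 ((L / 2 : ℕ) : ZMod L)) 1)| ≥
        |Real.cos (latticeMomentum L k 0) + Real.cos (latticeMomentum L k 1)| - π / L := by
      have := abs_sub_abs_le_abs_sub (Real.cos (latticeMomentum L k 0) + Real.cos (latticeMomentum L k 1))
        (Real.cos (latticeMomentum L (k + Pi.single 1 ((L / 2 : ℕ) : ZMod L)) 1) +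
          Real.cos (latticeMomentum L k 1))
      rw [show Real.cos (latticeMomentum L k 0) + Real.cos (latticeMomentum L k 1) -
        (Real.cos (latticeMomentum L (k + Pi.single 1 ((L / 2 : ℕ) : ZMod L)) 1) +
          Real.cos (latticeMomentum L k 1)) =
        Real.cos (latticeMomentum L k 0) -
          Real.cos (latticeMomentum L (k + Pi.single 1 ((L / 2 : ℕ) : ZMod L)) 1) by ring] at this
      linarith
    linarith
  have hinj := Finset.card_le_card_of_injOn T hTmaps hTinj
  have hBdle : Bd.card ≤ G.card + E.card :=
    (Finset.card_le_card_sdiff_add_card).trans (Nat.add_le_add_right hinj _)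
  -- the exceptional set is small
  have hEcard : (E.card : ℝ) ≤ L * (2 * ε * L + 2) := by
    rw [hE, card_filter_abs_cos_fst_lt, Nat.cast_mul]
    exact mul_le_mul_of_nonneg_left (card_abs_cos_lt_le (by positivity)) hL.le
  -- assemble
  have h1 : (G.card : ℝ) + Bd.card = (L : ℝ) ^ 2 := by rw [← hcardT]; exact_mod_cast hsplit
  have h2 : (Bd.card : ℝ) ≤ G.card + E.card := by exact_mod_cast hBdle
  rw [hε] at hEcard
  nlinarith [hEcard, h1, h2, hδL, hL]


end Literature.MathematicalPhysics.QuantumLattice
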